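import Literature.AlgebraicGeometry.Motives.MumfordTateInvariantsOrthonormalBasis
import Literature.RepresentationTheory.FiniteMonoids.InverseMonoidAlgebrasProofs
import HarnessLib

/-!
# The endomorphism algebra of a polarizable `ℚ`-Hodge structure is semisimple, with a positive involution

Family `hodge`, layer `Literature/AlgebraicGeometry/Motives` (lane `lit-hodgefound`, Layer B,
B2-20 / B2-39 / B66 «`HS^pol_ℚ` is a semisimple Tannakian subcategory of `HS_ℚ`», TREE side).
THEOREMS plus one plumbing `def` with body (the adjoint `a ↦ a†` of an endomorphism with respect
to a polarization, Mathlib's `LinearMap.BilinForm.leftAdjointOfNondegenerate`); no notion is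
introduced, nothing unproved is asserted (0 named facts).

Sources read verbatim. B. Moonen, *Families of Motives and the Mumford–Tate Conjecture*, Milan J.
Math. 85 (2017) [Moonen2017FamiliesMotives] (held text `paper:doi-10-1007-s00032-017-0273-x`, p. 3
L9), §2.1: "If `H` is a pure polarizable `ℚ`-Hodge structure, its endomorphism algebra
`D = End_{HS_ℚ}(H)` is a finite dimensional semisimple `ℚ`-algebra. The choice of a polarization
`φ` gives rise to an involution `d ↦ d*` on `D`, and it can be shown that this is a positive
involution. The pair `(D, *)` is therefore of the type classified by Albert". D. Huybrechts,
*Lectures on K3 Surfaces* (CUP 2016) [Huybrechts2016K3], §3.3.5 eq. (3.3) ("one defines an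
involution `a ↦ a'` by the condition `⟨av, w⟩ = ⟨v, a'w⟩` […] `a'` is the formal adjoint of
`a`") and Lemma 3.3.12 ("If `a ∈ K`, then `a' ∈ K`", the tree's
`Polarization.mem_endAlg_of_isAdjointPair`). D. Mumford, *Abelian Varieties* (1970)
[MumfordAV1970], §21 (algebras with a positive involution `Tr(x x*) > 0` are semisimple), H. Lange,
*Abelian Varieties over the Complex Numbers* (2023) [Lange2023AbelianVarietiesC], §2.4.1
Thm. 2.4.9 (positivity of the Rosati involution) — the abelian-variety instances of the statement.

In the tree `End_{HS}(H)` is the subalgebra `HodgeStructure.endAlg H ⊆ End_ℚ(V)` of endomorphisms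
whose complexification preserves the Hodge filtration (Huybrechts §3.3.3; `endAlg.toHom`,
`Hom.toLinearMap_mem_endAlg` identify it with `Hom H H`). The ring-theoretic core «an artinian ring
with an anti-involution `⋆` such that `a⋆ a = 0 ⇒ a = 0` is semisimple» is the tree's
`Literature.RepresentationTheory.FiniteMonoids.InverseMonoidAlgebra.isSemisimpleRing_of_star_mul_self`
(imported, not re-proved); the positivity input is the second Hodge–Riemann relation
(`Polarization.pos`, Voisin I §7.1.2) read in an `h`-orthonormal graded basis of `V_ℂ`
(`Polarization.exists_orthonormal_graded_basis`).

## What is proved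

For a pure `ℚ`-Hodge structure `H` of weight `n` on a finite-dimensional `V` and a polarization
`ψ`:

* `Polarization.adjoint ψ a = a†` — THE `ψ`-ADJOINT of `a ∈ End_ℚ(V)`:
  `ψ(a v, w) = ψ(v, a† w)` (`isAdjointPair_adjoint`) and `ψ(a† v, w) = ψ(v, a w)`
  (`isAdjointPair_adjoint_left`; left and right adjoints agree because `ψ` is `(-1)ⁿ`-symmetric,
  `isAdjointPair_symm`); uniqueness `eq_adjoint_of_isAdjointPair`; it is an anti-involution:
  `adjoint_adjoint` (`a†† = a`), `adjoint_mul` (`(ab)† = b† a†`), `adjoint_one`, `adjoint_zero`,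
  `adjoint_add`, `adjoint_smul`; and it preserves `End_{HS}(H)`: `adjoint_mem_endAlg` (Huybrechts
  Lemma 3.3.12).
* **Positivity** (Moonen: "a positive involution"): `Polarization.trace_adjoint_mul_self_nonneg` /
  **`Polarization.trace_adjoint_mul_self_pos`** — for `a ∈ End_{HS}(H)`, `Tr_V(a† a) ≥ 0`, and
  `> 0` if `a ≠ 0` (also `Tr_V(a a†) > 0`, `trace_mul_adjoint_self_pos`): in an `h`-orthonormal
  graded basis `e` of `V_ℂ`, `Tr_ℂ((a† a)_ℂ) = Σ_σ i^{p_σ} (i^{q_σ})⁻¹ ψ_ℂ(a_ℂ e_σ, conj (a_ℂ e_σ))`,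
  a sum of positive reals by the second Hodge–Riemann relation on `V^{p_σ,q_σ} ∋ a_ℂ e_σ`;
  hence `Polarization.eq_zero_of_adjoint_mul_self` (`a† a = 0 ⇒ a = 0`).
* **`isSemisimpleRing_endAlg`** — for polarizable `H`, `End_{HS}(H) = H.endAlg` is a semisimple
  ring (and a finite-dimensional `ℚ`-algebra, `finite_endAlg`): `End_{HS}(H)` is artinian and
  carries the anti-involution `†` with `a† a = 0 ⇒ a = 0`.
-/

noncomputable section

open scoped TensorProduct
open Complex

namespace Literature.AlgebraicGeometry.Motives

namespace HodgeStructure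

universe u

variable {V : Type u} [AddCommGroup V] [Module ℚ V] {n : ℤ} {H : HodgeStructure V n}

/-! ### Symmetry of adjoint pairs for a `(-1)ⁿ`-symmetric form -/

/-- For a polarization (a `(-1)ⁿ`-symmetric form, `ψ(w, v) = (-1)ⁿ ψ(v, w)`, Voisin I §7.1.2) the
relation "`g` is a `ψ`-adjoint of `f`", `ψ(f v, w) = ψ(v, g w)`, is symmetric in `(f, g)`:
`ψ(g v, w) = (-1)ⁿ ψ(w, g v) = (-1)ⁿ ψ(f w, v) = ψ(v, f w)` — left and right adjoints coincide
(Huybrechts §3.3.5: "`a'` is the formal adjoint of `a`"). [cite: Huybrechts2016K3, §3.3.5 eq. (3.3)]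
[cite: VoisinHodgeI2002, §7.1.2] -/
theorem Polarization.isAdjointPair_symm (ψ : Polarization H) {f g : Module.End ℚ V}
    (h : LinearMap.IsAdjointPair ψ.form ψ.form f g) : LinearMap.IsAdjointPair ψ.form ψ.form g f := by
  intro v w
  have hu : ((((n.negOnePow : ℤˣ) : ℤ) : ℚ)) * (((n.negOnePow : ℤˣ) : ℤ) : ℚ) = 1 := by
    rw [← Int.cast_mul, ← Units.val_mul, Int.units_mul_self, Units.val_one, Int.cast_one]
  calc ψ.form (g v) w = (((n.negOnePow : ℤˣ) : ℤ) : ℚ) * ψ.form w (g v) := ψ.form_swap w (g v)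
    _ = (((n.negOnePow : ℤˣ) : ℤ) : ℚ) * ψ.form (f w) v := by rw [h w v]
    _ = (((n.negOnePow : ℤˣ) : ℤ) : ℚ) * ((((n.negOnePow : ℤˣ) : ℤ) : ℚ) * ψ.form v (f w)) := by
        rw [ψ.form_swap v (f w)]
    _ = ψ.form v (f w) := by rw [← mul_assoc, hu, one_mul]

/-- Uniqueness of adjoints: a non-degenerate form admits at most one `ψ`-adjoint of a given `f`
(`ψ(f v, w) = ψ(v, g w) = ψ(v, g' w)` for all `v, w` forces `g = g'`).
[cite: Huybrechts2016K3, §3.3.5 eq. (3.3)] -/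
theorem Polarization.isAdjointPair_unique (ψ : Polarization H) {f g g' : Module.End ℚ V}
    (h : LinearMap.IsAdjointPair ψ.form ψ.form f g) (h' : LinearMap.IsAdjointPair ψ.form ψ.form f g') :
    g = g' := by
  refine LinearMap.ext fun w => ?_
  rw [← sub_eq_zero, ← LinearMap.sub_apply]
  refine ψ.nondegenerate.2 _ fun v => ?_
  rw [LinearMap.sub_apply, map_sub, ← h v w, ← h' v w, sub_self]

/-! ### The adjoint (Rosati) involution of a polarization -/

section Adjoint

variable [Module.Finite ℚ V]

/-- **The `ψ`-adjoint `a†` of an endomorphism** `a ∈ End_ℚ(V)` with respect to a polarization `ψ`: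
the unique `a†` with `ψ(a v, w) = ψ(v, a† w)` (Huybrechts §3.3.5, eq. (3.3): "one defines an
involution `a ↦ a'` by the condition `⟨av, w⟩ = ⟨v, a'w⟩`"; Moonen §2.1: "the choice of a
polarization gives rise to an involution `d ↦ d*` on `D`") — Mathlib's left adjoint for the
non-degenerate form `ψ` (`Polarization.nondegenerate`), which is also the right adjoint
(`isAdjointPair_symm`). [cite: Huybrechts2016K3, §3.3.5 eq. (3.3)]
[cite: Moonen2017FamiliesMotives, §2.1 (p. 3)] -/
def Polarization.adjoint (ψ : Polarization H) (a : Module.End ℚ V) : Module.End ℚ V :=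
  ψ.form.leftAdjointOfNondegenerate ψ.nondegenerate a

/-- `ψ(a† v, w) = ψ(v, a w)`. [cite: Huybrechts2016K3, §3.3.5 eq. (3.3)] -/
theorem Polarization.isAdjointPair_adjoint_left (ψ : Polarization H) (a : Module.End ℚ V) :
    LinearMap.IsAdjointPair ψ.form ψ.form (ψ.adjoint a) a :=
  ψ.form.isAdjointPairLeftAdjointOfNondegenerate ψ.nondegenerate a

/-- **`ψ(a v, w) = ψ(v, a† w)`.** [cite: Huybrechts2016K3, §3.3.5 eq. (3.3)] -/
theorem Polarization.isAdjointPair_adjoint (ψ : Polarization H) (a : Module.End ℚ V) :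
    LinearMap.IsAdjointPair ψ.form ψ.form a (ψ.adjoint a) :=
  ψ.isAdjointPair_symm (ψ.isAdjointPair_adjoint_left a)

/-- `ψ(a v, w) = ψ(v, a† w)`, elementwise. [cite: Huybrechts2016K3, §3.3.5 eq. (3.3)] -/
theorem Polarization.form_apply_adjoint (ψ : Polarization H) (a : Module.End ℚ V) (v w : V) :
    ψ.form v (ψ.adjoint a w) = ψ.form (a v) w :=
  (ψ.isAdjointPair_adjoint a v w).symm

/-- **Uniqueness**: any `ψ`-adjoint of `a` is `a†`. [cite: Huybrechts2016K3, §3.3.5 eq. (3.3)] -/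
theorem Polarization.eq_adjoint_of_isAdjointPair (ψ : Polarization H) {a b : Module.End ℚ V}
    (h : LinearMap.IsAdjointPair ψ.form ψ.form a b) : b = ψ.adjoint a :=
  ψ.isAdjointPair_unique h (ψ.isAdjointPair_adjoint a)

/-- **`a†† = a`** (`†` is an involution). [cite: Huybrechts2016K3, §3.3.5 eq. (3.3)] -/
@[simp]
theorem Polarization.adjoint_adjoint (ψ : Polarization H) (a : Module.End ℚ V) :
    ψ.adjoint (ψ.adjoint a) = a :=
  (ψ.eq_adjoint_of_isAdjointPair (ψ.isAdjointPair_adjoint_left a)).symm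

/-- **`(a b)† = b† a†`** (`†` is an anti-homomorphism). [cite: Huybrechts2016K3, §3.3.5 eq. (3.3)] -/
theorem Polarization.adjoint_mul (ψ : Polarization H) (a b : Module.End ℚ V) :
    ψ.adjoint (a * b) = ψ.adjoint b * ψ.adjoint a :=
  (ψ.eq_adjoint_of_isAdjointPair ((ψ.isAdjointPair_adjoint a).mul (ψ.isAdjointPair_adjoint b))).symm

/-- `1† = 1`. [cite: Huybrechts2016K3, §3.3.5 eq. (3.3)] -/
@[simp]
theorem Polarization.adjoint_one (ψ : Polarization H) : ψ.adjoint 1 = 1 :=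
  (ψ.eq_adjoint_of_isAdjointPair LinearMap.isAdjointPair_one).symm

/-- `0† = 0`. [cite: Huybrechts2016K3, §3.3.5 eq. (3.3)] -/
@[simp]
theorem Polarization.adjoint_zero (ψ : Polarization H) : ψ.adjoint 0 = 0 :=
  (ψ.eq_adjoint_of_isAdjointPair (fun v w => by simp)).symm

/-- `(a + b)† = a† + b†`. [cite: Huybrechts2016K3, §3.3.5 eq. (3.3)] -/
theorem Polarization.adjoint_add (ψ : Polarization H) (a b : Module.End ℚ V) :
    ψ.adjoint (a + b) = ψ.adjoint a + ψ.adjoint b := by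
  refine (ψ.eq_adjoint_of_isAdjointPair fun v w => ?_).symm
  rw [LinearMap.add_apply, LinearMap.add_apply, map_add, LinearMap.add_apply, map_add,
    ψ.form_apply_adjoint, ψ.form_apply_adjoint]

/-- `(c • a)† = c • a†`. [cite: Huybrechts2016K3, §3.3.5 eq. (3.3)] -/
theorem Polarization.adjoint_smul (ψ : Polarization H) (c : ℚ) (a : Module.End ℚ V) :
    ψ.adjoint (c • a) = c • ψ.adjoint a := by
  refine (ψ.eq_adjoint_of_isAdjointPair fun v w => ?_).symm
  rw [LinearMap.smul_apply, LinearMap.smul_apply, map_smul, LinearMap.smul_apply, map_smul,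
    ψ.form_apply_adjoint]

/-- **Huybrechts, Lemma 3.3.12: `End_{HS}(H)` is stable under `†`** — the adjoint of a Hodge
endomorphism is a Hodge endomorphism (the tree's `Polarization.mem_endAlg_of_isAdjointPair`).
[cite: Huybrechts2016K3, Lemma 3.3.12] -/
theorem Polarization.adjoint_mem_endAlg (ψ : Polarization H) {a : Module.End ℚ V}
    (ha : a ∈ H.endAlg) : ψ.adjoint a ∈ H.endAlg :=
  ψ.mem_endAlg_of_isAdjointPair ha (ψ.isAdjointPair_adjoint a)

/-- Complexified adjunction: `ψ_ℂ((a†)_ℂ x, y) = ψ_ℂ(x, a_ℂ y)`. [cite: Huybrechts2016K3, §3.3.5] -/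
theorem Polarization.form_baseChange_adjoint_left (ψ : Polarization H) (a : Module.End ℚ V)
    (x y : ℂ ⊗[ℚ] V) :
    ψ.form.baseChange ℂ ((ψ.adjoint a).baseChange ℂ x) y = ψ.form.baseChange ℂ x (a.baseChange ℂ y) :=
  isAdjointPair_baseChange (ψ.isAdjointPair_adjoint_left a) x y

end Adjoint

/-! ### Coordinates in an `h`-orthonormal graded basis -/

/-- In an `h`-orthonormal basis `e` of `V_ℂ` (`ψ_ℂ(e σ, conj (e τ)) = δ_{στ} (hodgeSign n (deg σ))⁻¹`)
the `σ`-th coordinate of `y` is `hodgeSign n (deg σ) · ψ_ℂ(y, conj (e σ))` (Fourier coefficient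
for the Hodge form `h(x, y) = i^{p-q} ψ_ℂ(x, conj y)`, Voisin I §7.1.2).
[cite: VoisinHodgeI2002, §7.1.2 Def. 7.7] -/
theorem Polarization.repr_eq_hodgeSign_mul_form (ψ : Polarization H) {S : Type*} [Fintype S]
    [DecidableEq S] {deg : S → ℤ} (e : Module.Basis S ℂ (ℂ ⊗[ℚ] V))
    (hon : ∀ σ τ, ψ.form.baseChange ℂ (e σ) (conj (e τ)) =
      if σ = τ then (hodgeSign n (deg σ))⁻¹ else 0)
    (y : ℂ ⊗[ℚ] V) (σ : S) :
    e.repr y σ = hodgeSign n (deg σ) * ψ.form.baseChange ℂ y (conj (e σ)) := by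
  conv_rhs => rw [← e.sum_repr y]
  rw [map_sum, LinearMap.sum_apply]
  simp_rw [map_smul, LinearMap.smul_apply, smul_eq_mul, hon, mul_ite, mul_zero, Finset.sum_ite_eq',
    Finset.mem_univ, if_true]
  rw [mul_left_comm, mul_inv_cancel₀ (hodgeSign_ne_zero n (deg σ)), mul_one]

/-! ### Positivity of the adjoint involution -/

/-- An endomorphism of `V` whose complexification vanishes is zero (`V → V_ℂ`, `v ↦ 1 ⊗ v`, is
injective, the tree's `ofRat_injective`). Private plumbing. [folklore] -/
private theorem endo_eq_zero_of_baseChange_eq_zero_aux {a : Module.End ℚ V} (h : a.baseChange ℂ = 0) :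
    a = 0 := by
  refine LinearMap.ext fun v => ofRat_injective (V := V) ?_
  have h1 := LinearMap.congr_fun h (ofRat v)
  rw [ofRat_apply, LinearMap.baseChange_tmul, LinearMap.zero_apply] at h1
  rw [ofRat_apply, h1, LinearMap.zero_apply, ofRat_apply, TensorProduct.tmul_zero]

section Positivity

variable [Module.Finite ℚ V]

/-- **The trace form of the adjoint involution, computed in an `h`-orthonormal graded basis.**
For `a ∈ End_{HS}(H)`: `Tr_V(a† a)`, viewed in `ℂ`, is a sum `Σ_σ r_σ` of reals `r_σ ≥ 0` with
`r_σ > 0` as soon as `a_ℂ e_σ ≠ 0` — namely `r_σ = i^{p_σ} (i^{q_σ})⁻¹ ψ_ℂ(a_ℂ e_σ, conj (a_ℂ e_σ))`,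
`a_ℂ e_σ ∈ V^{p_σ, q_σ}` (second Hodge–Riemann relation). Private plumbing for the two public
statements below. [folklore] -/
private theorem trace_adjoint_mul_self_aux (ψ : Polarization H) {a : Module.End ℚ V}
    (ha : a ∈ H.endAlg) :
    ∃ r : ℝ, 0 ≤ r ∧ (a ≠ 0 → 0 < r) ∧
      ((LinearMap.trace ℚ V (ψ.adjoint a * a) : ℚ) : ℂ) = r := by
  obtain ⟨S, _, _, deg, e, -, -, he, hon⟩ := ψ.exists_orthonormal_graded_basis
  -- the vectors `z σ = a_ℂ (e σ) ∈ V^{deg σ, n - deg σ}`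
  set z : S → ℂ ⊗[ℚ] V := fun σ => a.baseChange ℂ (e σ) with hz_def
  have hz : ∀ σ, z σ ∈ H.piece (deg σ) (n - deg σ) := fun σ =>
    endAlg.baseChange_mem_piece ⟨a, ha⟩ (he σ)
  have hd : ∀ σ, ∃ r : ℝ, 0 ≤ r ∧ (z σ ≠ 0 → 0 < r) ∧
      hodgeSign n (deg σ) * ψ.form.baseChange ℂ (z σ) (conj (z σ)) = r := by
    intro σ
    by_cases hz0 : z σ = 0
    · exact ⟨0, le_rfl, fun h => absurd hz0 h, by simp [hz0]⟩
    · obtain ⟨r, hr, h⟩ := ψ.pos (deg σ) (n - deg σ) (by ring) (z σ) (hz σ) hz0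
      exact ⟨r, hr.le, fun _ => hr, h⟩
  choose r hr0 hrpos hr using hd
  -- the diagonal matrix coefficients of `(a† a)_ℂ` in the basis `e` are the `r σ`
  have hdiag : ∀ σ, e.repr ((ψ.adjoint a * a).baseChange ℂ (e σ)) σ = r σ := by
    intro σ
    rw [ψ.repr_eq_hodgeSign_mul_form e hon, Module.End.mul_eq_comp, LinearMap.baseChange_comp,
      LinearMap.comp_apply, ψ.form_baseChange_adjoint_left, ← conj_baseChange]
    exact hr σ
  refine ⟨∑ σ, r σ, Finset.sum_nonneg fun σ _ => hr0 σ, fun ha0 => ?_, ?_⟩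
  · -- some `z σ ≠ 0`, since `a_ℂ ≠ 0`
    have hex : ∃ σ, z σ ≠ 0 := by
      by_contra hall
      simp only [not_exists, not_not] at hall
      exact ha0 (endo_eq_zero_of_baseChange_eq_zero_aux (e.ext fun σ => by
        rw [LinearMap.zero_apply]; exact hall σ))
    obtain ⟨σ, hσ⟩ := hex
    exact Finset.sum_pos' (fun τ _ => hr0 τ) ⟨σ, Finset.mem_univ _, hrpos σ hσ⟩
  · rw [Complex.ofReal_sum, ← eq_ratCast (algebraMap ℚ ℂ), ← LinearMap.trace_baseChange,
      LinearMap.trace_eq_matrix_trace ℂ e]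
    simp only [Matrix.trace, Matrix.diag_apply, LinearMap.toMatrix_apply]
    exact Finset.sum_congr rfl fun σ _ => hdiag σ

/-- **The adjoint involution is positive, I:** `Tr_V(a† a) ≥ 0` for every Hodge endomorphism `a`
(Moonen §2.1: "it can be shown that this is a positive involution"; in an `h`-orthonormal graded
basis the trace is `Σ_σ h(a_ℂ e_σ, a_ℂ e_σ)`). [cite: Moonen2017FamiliesMotives, §2.1 (p. 3)]
[cite: VoisinHodgeI2002, §7.1.2 Def. 7.7] -/
theorem Polarization.trace_adjoint_mul_self_nonneg (ψ : Polarization H) {a : Module.End ℚ V}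
    (ha : a ∈ H.endAlg) : 0 ≤ LinearMap.trace ℚ V (ψ.adjoint a * a) := by
  obtain ⟨r, hr0, -, hr⟩ := trace_adjoint_mul_self_aux ψ ha
  have h : ((LinearMap.trace ℚ V (ψ.adjoint a * a) : ℚ) : ℝ) = r :=
    Complex.ofReal_injective (by rw [Complex.ofReal_ratCast, hr])
  exact_mod_cast (h ▸ hr0 : (0 : ℝ) ≤ (LinearMap.trace ℚ V (ψ.adjoint a * a) : ℚ))

/-- **The adjoint involution is positive, II (Moonen §2.1; Mumford §21):** `Tr_V(a† a) > 0` for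
every non-zero Hodge endomorphism `a ∈ End_{HS}(H)` — some `a_ℂ e_σ ≠ 0`, and its term
`i^{p-q} ψ_ℂ(a_ℂ e_σ, conj (a_ℂ e_σ))` is `> 0` by the second Hodge–Riemann relation.
[cite: Moonen2017FamiliesMotives, §2.1 (p. 3)] [cite: MumfordAV1970, §21] -/
theorem Polarization.trace_adjoint_mul_self_pos (ψ : Polarization H) {a : Module.End ℚ V}
    (ha : a ∈ H.endAlg) (ha0 : a ≠ 0) : 0 < LinearMap.trace ℚ V (ψ.adjoint a * a) := by
  obtain ⟨r, -, hrpos, hr⟩ := trace_adjoint_mul_self_aux ψ ha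
  have h : ((LinearMap.trace ℚ V (ψ.adjoint a * a) : ℚ) : ℝ) = r :=
    Complex.ofReal_injective (by rw [Complex.ofReal_ratCast, hr])
  exact_mod_cast (h ▸ hrpos ha0 : (0 : ℝ) < (LinearMap.trace ℚ V (ψ.adjoint a * a) : ℚ))

/-- The same with the factors exchanged: `Tr_V(a a†) > 0` for `0 ≠ a ∈ End_{HS}(H)` (Moonen's
`Tr(d d*) > 0`; `Tr(a a†) = Tr(a† a)`). [cite: Moonen2017FamiliesMotives, §2.1 (p. 3)] -/
theorem Polarization.trace_mul_adjoint_self_pos (ψ : Polarization H) {a : Module.End ℚ V}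
    (ha : a ∈ H.endAlg) (ha0 : a ≠ 0) : 0 < LinearMap.trace ℚ V (a * ψ.adjoint a) := by
  rw [LinearMap.trace_mul_comm]
  exact ψ.trace_adjoint_mul_self_pos ha ha0

/-- **`a† a = 0 ⇒ a = 0`** for a Hodge endomorphism `a` (the involution is anisotropic; from
`Tr_V(a† a) > 0` for `a ≠ 0`). [cite: Moonen2017FamiliesMotives, §2.1 (p. 3)] [cite: MumfordAV1970, §21] -/
theorem Polarization.eq_zero_of_adjoint_mul_self (ψ : Polarization H) {a : Module.End ℚ V}
    (ha : a ∈ H.endAlg) (h : ψ.adjoint a * a = 0) : a = 0 := by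
  by_contra ha0
  have hpos := ψ.trace_adjoint_mul_self_pos ha ha0
  rw [h, map_zero] at hpos
  exact lt_irrefl _ hpos

end Positivity

/-! ### `End_{HS}(H)` is a finite-dimensional semisimple `ℚ`-algebra -/

section Semisimple

variable [Module.Finite ℚ V]

/-- `End_{HS}(H) ⊆ End_ℚ(V)` is finite-dimensional over `ℚ` (Moonen §2.1: "a finite dimensional
[…] `ℚ`-algebra"). [cite: Moonen2017FamiliesMotives, §2.1 (p. 3)] -/
theorem finite_endAlg (H : HodgeStructure V n) : Module.Finite ℚ H.endAlg :=
  Module.Finite.of_injective H.endAlg.val.toLinearMap Subtype.val_injective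

/-- **The endomorphism algebra of a polarizable `ℚ`-Hodge structure is semisimple** (Moonen §2.1:
"its endomorphism algebra `D = End_{HS_ℚ}(H)` is a finite dimensional semisimple `ℚ`-algebra"):
`End_{HS}(H)` is artinian (finite-dimensional) and the adjoint involution `†` of a polarization is
an anti-involution of it (`adjoint_mem_endAlg`, `adjoint_mul`, `adjoint_adjoint`) with
`a† a = 0 ⇒ a = 0` (`eq_zero_of_adjoint_mul_self`), so its Jacobson radical vanishes (the tree's
`InverseMonoidAlgebra.isSemisimpleRing_of_star_mul_self`; Mumford §21).
[cite: Moonen2017FamiliesMotives, §2.1 (p. 3)] [cite: MumfordAV1970, §21] -/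
theorem isSemisimpleRing_endAlg {H : HodgeStructure V n} (hH : H.IsPolarizable) :
    IsSemisimpleRing H.endAlg := by
  obtain ⟨ψ⟩ := hH
  haveI : Module.Finite ℚ H.endAlg := finite_endAlg H
  haveI : IsArtinianRing H.endAlg := IsArtinianRing.of_finite ℚ H.endAlg
  refine Literature.RepresentationTheory.FiniteMonoids.InverseMonoidAlgebra.isSemisimpleRing_of_star_mul_self
    (fun a : H.endAlg => (⟨ψ.adjoint a, ψ.adjoint_mem_endAlg a.2⟩ : H.endAlg))
    (fun a b => Subtype.ext (ψ.adjoint_mul a b)) (fun a => Subtype.ext (ψ.adjoint_adjoint a))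
    fun a h => Subtype.ext (ψ.eq_zero_of_adjoint_mul_self a.2 (congrArg Subtype.val h))

end Semisimple

end HodgeStructure

end Literature.AlgebraicGeometry.Motives

end
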